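import Literature.Analysis.FluidPDE.WholeSpaceIBP
import Mathlib.Analysis.Calculus.DerivativeTest
import HarnessLib

/-!
# A comparison principle for drift–diffusion (super)solutions in time-integrated form

Analysis/FluidPDE proofs file (theorems only). It proves the weak maximum / comparison principle
of Lieberman, *Second Order Parabolic Differential Equations* (1996), Ch. II §1 (Lemma 2.1,
Lemma 2.3, Corollary 2.5: "`Lu ≥ Lv` in `Ω` and `u ≤ v` on `𝒫Ω` implies `u ≤ v` in `Ω`", proved
by looking at a positive maximum `X` of `u − v`, where "`v_t(X) ≥ 0`, `Dv(X) = 0`, `D²v(X)` is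
nonpositive") in the form needed for KNSS 2009, Lemma 2.1 on a finite-dimensional inner product
space `E`:

* the domain is an **expanding paraboloid** `K = {(t, x) : t_b ≤ t ≤ t_T, |x − y|² ≤ P(t)}` with
  parabolic boundary its bottom `{t = t_b}` and its side `{|x − y|² = P(t)}` (Lieberman's `Q̃` in
  the proof of Lemma 2.6);
* the subsolution `v` (the barrier) is classical: `C²` slices, a classical time derivative `vₜ`,
  and `vₜ ≤ Δv − A |Dv|` inside the paraboloid (so `vₜ ≤ Δv + a·Dv` for *every* drift `|a| ≤ A`);
* the supersolution `g` is in the **time-integrated class** of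
  `Literature.Analysis.FluidPDE.KNSS2009_lemma21_halfball`: `C²` slices, `Dg`, `Δg` continuous in
  `t`, and `g(t) − g(s) = ∫ₛᵗ (Δg − Dg[a]) dτ` with a bounded, merely measurable drift `a`
  (no time derivative of `g` is ever formed).

Main results:

* `IsLocalMax.laplacian_nonpos` — at an interior local maximum of a `C²` function, `Δ ≤ 0`
  (second-derivative test along the lines of an orthonormal frame);
* `paraboloid_comparison` — `v ≤ g` on the bottom and the side of `K` implies `v ≤ g` on `K`.
  Proof (Lieberman, Lemma 2.1/2.3): a positive maximum `X* = (t*, x*)` of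
  `w = v − g − θ(t − t_b)` on the compact `K` lies off the parabolic boundary; there `Dw = 0`,
  `Δw ≤ 0`, and `w(t*, x*) − w(t, x*) = ∫ₜ^{t*} (vₜ − Δg + Dg[a] − θ) ≤ ∫ₜ^{t*} (Δw − θ + o(1)) < 0`
  for `t` slightly below `t*`, contradicting maximality; then `θ → 0`.

## References

* G. M. Lieberman, *Second Order Parabolic Differential Equations*, World Scientific (1996),
  Ch. II §1, Lemma 2.1, Lemma 2.3, Corollary 2.5 (pp. 7–10); §2, proof of Lemma 2.6 (the domain
  `Q̃`). [Lieberman1996]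
-/

noncomputable section

open MeasureTheory Set Function Filter TopologicalSpace InnerProductSpace Metric
open scoped RealInnerProductSpace Laplacian ContDiff Topology

namespace Literature.Analysis.FluidPDE

variable {E : Type*} [NormedAddCommGroup E] [InnerProductSpace ℝ E] [FiniteDimensional ℝ E]

/-! ### Second-order conditions at an interior maximum -/

section LocalMax

omit [FiniteDimensional ℝ E] in
/-- Along a line: `s ↦ W(x + s e)` has derivative `DW(x + s e) e`. [folklore] -/
theorem hasDerivAt_comp_line {W : E → ℝ} (hW : Differentiable ℝ W) (x e : E) (s : ℝ) :
    HasDerivAt (fun σ : ℝ => W (x + σ • e)) (fderiv ℝ W (x + s • e) e) s := by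
  have hl : HasDerivAt (fun σ : ℝ => x + σ • e) e s := by
    simpa using ((hasDerivAt_id s).smul_const e).const_add x
  exact (hW (x + s • e)).hasFDerivAt.comp_hasDerivAt s hl

/-- **One-dimensional second-derivative test, necessary form**: if a function with a second
derivative has a local maximum at `σ₀` where it is continuous and `φ'` vanishes, then
`φ''(σ₀) ≤ 0` — otherwise the second-derivative test makes `σ₀` also a local minimum, `φ` is
locally constant and `φ''(σ₀) = 0`. [folklore] -/
theorem IsLocalMax.deriv_deriv_nonpos {φ : ℝ → ℝ} {σ₀ : ℝ} (h : IsLocalMax φ σ₀)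
    (hc : ContinuousAt φ σ₀) : deriv (deriv φ) σ₀ ≤ 0 := by
  by_contra hpos
  push Not at hpos
  have hd : deriv φ σ₀ = 0 := h.deriv_eq_zero
  have hmin : IsLocalMin φ σ₀ := isLocalMin_of_deriv_deriv_pos hpos hd hc
  have heq : φ =ᶠ[𝓝 σ₀] fun _ => φ σ₀ :=
    (h.and hmin).mono fun s hs => le_antisymm hs.1 hs.2
  have h1 : deriv φ =ᶠ[𝓝 σ₀] deriv fun _ : ℝ => φ σ₀ := heq.deriv
  have h2 : deriv (deriv φ) σ₀ = deriv (deriv fun _ : ℝ => φ σ₀) σ₀ := h1.deriv_eq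
  rw [h2] at hpos
  simp at hpos

/-- **At an interior local maximum of a `C²` function the Laplacian is nonpositive** (the
"`D²u(X)` is nonpositive definite" step of Lieberman 1996, Lemma 2.1/2.3; here via the lines
`s ↦ W(x + s eᵢ)` of an orthonormal frame and `Δ W = Σᵢ ∂ᵢ∂ᵢ W`). [cite: Lieberman1996, Ch. II Lemma 2.1 (proof)] -/
theorem IsLocalMax.laplacian_nonpos {W : E → ℝ} {x : E} (hW : ContDiff ℝ 2 W)
    (h : IsLocalMax W x) : (Δ W) x ≤ 0 := by
  rw [laplacian_eq_iteratedFDeriv_orthonormalBasis W (stdOrthonormalBasis ℝ E)]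
  refine Finset.sum_nonpos fun i _ => ?_
  set e : E := stdOrthonormalBasis ℝ E i
  set φ : ℝ → ℝ := fun σ => W (x + σ • e) with hφ
  have hWd : Differentiable ℝ W := hW.differentiable two_ne_zero
  -- first derivative along the line
  have hφ1 : deriv φ = fun σ => fderiv ℝ W (x + σ • e) e :=
    funext fun σ => (hasDerivAt_comp_line hWd x e σ).deriv
  -- second derivative along the line at `0`
  have hD1 : ContDiff ℝ 1 fun z => fderiv ℝ W z e :=
    (hW.fderiv_right (m := 1) le_rfl).clm_apply contDiff_const
  have hφ2 : deriv (deriv φ) 0 = iteratedFDeriv ℝ 2 W x ![e, e] := by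
    rw [hφ1, ← fderiv_fderiv_apply_const hW x e]
    have h2 := hasDerivAt_comp_line (hD1.differentiable one_ne_zero) x e 0
    rw [zero_smul, add_zero] at h2
    exact h2.deriv
  -- `φ` has a local maximum at `0`
  have hmax : IsLocalMax φ 0 := by
    have hx : IsLocalMax W ((fun σ : ℝ => x + σ • e) 0) := by
      rw [show (fun σ : ℝ => x + σ • e) 0 = x by simp]
      exact h
    have hl : ContinuousAt (fun σ : ℝ => x + σ • e) 0 := by fun_prop
    exact IsLocalMax.comp_continuous (g := fun σ : ℝ => x + σ • e) hx hl
  have hcφ : ContinuousAt φ 0 := (hWd.continuous.comp (by fun_prop)).continuousAt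
  rw [← hφ2]
  exact IsLocalMax.deriv_deriv_nonpos hmax hcφ

end LocalMax

/-! ### The comparison principle on an expanding paraboloid -/

section Comparison

/-- **Comparison principle on an expanding paraboloid, time-integrated supersolutions**
(Lieberman 1996, Ch. II, Corollary 2.5 with Lemma 2.1/2.3, on the domain `Q̃` of Lemma 2.6).
Data: a centre `y`, times `t_b ≤ t_T`, a continuous `P`, the region
`K = {(t, x) : t ∈ [t_b, t_T], |x − y|² ≤ P(t)}`; a drift bound `A ≥ 0`.
* `v` (subsolution): jointly continuous on `[t_b, t_T] × E`, `C²` slices, a classical time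
  derivative `vₜ` on `[t_b, t_T]` with `vₜ`, `Dv`, `Δv` continuous in `t ∈ [t_b, t_T]` at each `x`,
  and `vₜ ≤ Δv − A |Dv|` at the points of `K` off its bottom and side;
* `g` (supersolution): continuous on `[t_b, t_T] × E`, `C²` slices for `t ∈ (t_b, t_T]`, `Dg` and
  `Δg` continuous in `t ∈ (t_b, t_T]` at each `x`, and
  `g(t, x) − g(s, x) = ∫ₛᵗ (Δg(τ, ·)(x) − Dg(τ, ·)(x)[a(τ, x)]) dτ` for `t_b < s ≤ t ≤ t_T`, with an
  integrable integrand and `|a| ≤ A`.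
If `v ≤ g` on the bottom `{t = t_b}` and on the side `{|x − y|² = P(t)}`, then `v ≤ g` on `K`. [cite: Lieberman1996, Ch. II Cor. 2.5 with Lemma 2.1, Lemma 2.3 (pp. 7–10)] -/
theorem paraboloid_comparison {y : E} {t_b t_T : ℝ} (htt : t_b ≤ t_T) {P : ℝ → ℝ}
    (hPc : Continuous P) {v g vt : ℝ → E → ℝ} {a : ℝ → E → E} {A : ℝ}
    (hv_c : ContinuousOn (uncurry v) (Icc t_b t_T ×ˢ univ)) (hv2 : ∀ t, ContDiff ℝ 2 (v t))
    (hvt : ∀ x, ∀ t ∈ Icc t_b t_T, HasDerivAt (fun τ => v τ x) (vt t x) t)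
    (hvt_c : ∀ x, ContinuousOn (fun τ => vt τ x) (Icc t_b t_T))
    (hvD_c : ∀ x, ContinuousOn (fun τ => fderiv ℝ (v τ) x) (Icc t_b t_T))
    (hvΔ_c : ∀ x, ContinuousOn (fun τ => (Δ (v τ)) x) (Icc t_b t_T))
    (hv_ineq : ∀ t ∈ Ioc t_b t_T, ∀ x, ‖x - y‖ ^ 2 < P t →
      vt t x ≤ (Δ (v t)) x - A * ‖fderiv ℝ (v t) x‖)
    (hg_c : ContinuousOn (uncurry g) (Icc t_b t_T ×ˢ univ))
    (hg2 : ∀ t ∈ Ioc t_b t_T, ContDiff ℝ 2 (g t))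
    (hgD_c : ∀ x, ContinuousOn (fun τ => fderiv ℝ (g τ) x) (Ioc t_b t_T))
    (hgΔ_c : ∀ x, ContinuousOn (fun τ => (Δ (g τ)) x) (Ioc t_b t_T))
    (ha : ∀ τ ∈ Ioc t_b t_T, ∀ x, ‖a τ x‖ ≤ A)
    (hint : ∀ x, ∀ s t : ℝ, t_b < s → s ≤ t → t ≤ t_T →
      IntervalIntegrable (fun τ => (Δ (g τ)) x - fderiv ℝ (g τ) x (a τ x)) volume s t)
    (hg_eq : ∀ x, ∀ s t : ℝ, t_b < s → s ≤ t → t ≤ t_T →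
      g t x - g s x = ∫ τ in s..t, ((Δ (g τ)) x - fderiv ℝ (g τ) x (a τ x)))
    (hbot : ∀ x, ‖x - y‖ ^ 2 ≤ P t_b → v t_b x ≤ g t_b x)
    (hside : ∀ t ∈ Icc t_b t_T, ∀ x, ‖x - y‖ ^ 2 = P t → v t x ≤ g t x) :
    ∀ t ∈ Icc t_b t_T, ∀ x, ‖x - y‖ ^ 2 ≤ P t → v t x ≤ g t x := by
  -- the compact region `K`
  set K : Set (ℝ × E) := {p | p.1 ∈ Icc t_b t_T ∧ ‖p.2 - y‖ ^ 2 ≤ P p.1} with hK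
  obtain ⟨MP, hMP⟩ : ∃ MP : ℝ, ∀ t ∈ Icc t_b t_T, P t ≤ MP := by
    obtain ⟨MP, hMP⟩ := (isCompact_Icc (a := t_b) (b := t_T)).bddAbove_image hPc.continuousOn
    exact ⟨MP, fun t ht => hMP ⟨t, ht, rfl⟩⟩
  have hKsub : K ⊆ Icc t_b t_T ×ˢ closedBall y (Real.sqrt (max MP 0)) := by
    rintro ⟨t, x⟩ ⟨ht, hx⟩
    refine ⟨ht, ?_⟩
    rw [mem_closedBall, dist_eq_norm]
    have h1 : ‖x - y‖ ^ 2 ≤ max MP 0 := (hx.trans (hMP t ht)).trans (le_max_left _ _)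
    calc ‖x - y‖ = Real.sqrt (‖x - y‖ ^ 2) := (Real.sqrt_sq (norm_nonneg _)).symm
      _ ≤ Real.sqrt (max MP 0) := Real.sqrt_le_sqrt h1
  have hKclosed : IsClosed K := by
    refine (isClosed_Icc.preimage continuous_fst).inter ?_
    exact isClosed_le ((continuous_snd.sub continuous_const).norm.pow 2) (hPc.comp continuous_fst)
  have hKc : IsCompact K :=
    (isCompact_Icc.prod (isCompact_closedBall _ _)).of_isClosed_subset hKclosed hKsub
  have hKmem : ∀ {t : ℝ} {x : E}, t ∈ Icc t_b t_T → ‖x - y‖ ^ 2 ≤ P t → (t, x) ∈ K :=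
    fun ht hx => ⟨ht, hx⟩
  -- the claim for every `θ > 0`
  have main : ∀ θ : ℝ, 0 < θ → ∀ p ∈ K, v p.1 p.2 - g p.1 p.2 - θ * (p.1 - t_b) ≤ 0 := by
    intro θ hθ
    set w : ℝ × E → ℝ := fun p => v p.1 p.2 - g p.1 p.2 - θ * (p.1 - t_b) with hw
    have hKsub' : K ⊆ Icc t_b t_T ×ˢ univ := by
      rintro ⟨t, x⟩ ⟨ht, -⟩; exact ⟨ht, mem_univ _⟩
    have hwc : ContinuousOn w K := by
      refine (((hv_c.mono hKsub').sub (hg_c.mono hKsub')).sub ?_)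
      exact (continuous_const.mul (continuous_fst.sub continuous_const)).continuousOn
    by_contra hcon
    push Not at hcon
    obtain ⟨p₁, hp₁K, hp₁⟩ := hcon
    obtain ⟨X, hXK, hXmax⟩ := hKc.exists_isMaxOn ⟨p₁, hp₁K⟩ hwc
    have hXpos : 0 < w X := hp₁.trans_le (hXmax hp₁K)
    obtain ⟨ts, xs⟩ := X
    obtain ⟨htsI, hxs⟩ := hXK
    -- not on the bottom
    have hts_ne : ts ≠ t_b := by
      intro h
      subst h
      have := hbot xs hxs
      simp [hw] at hXpos
      linarith
    have hts_gt : t_b < ts := lt_of_le_of_ne htsI.1 (Ne.symm hts_ne)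
    have htsIoc : ts ∈ Ioc t_b t_T := ⟨hts_gt, htsI.2⟩
    -- not on the side
    have hxs_lt : ‖xs - y‖ ^ 2 < P ts := by
      refine lt_of_le_of_ne hxs fun h => ?_
      have h1 := hside ts htsI xs h
      have h2 : 0 ≤ θ * (ts - t_b) := mul_nonneg hθ.le (by linarith)
      simp [hw] at hXpos
      linarith
    -- spatial local maximum at `xs`
    set W : E → ℝ := fun x => v ts x - g ts x - θ * (ts - t_b) with hW
    have hW2 : ContDiff ℝ 2 W := ((hv2 ts).sub (hg2 ts htsIoc)).sub contDiff_const
    have hWmax : IsLocalMax W xs := by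
      have hU : {x : E | ‖x - y‖ ^ 2 < P ts} ∈ 𝓝 xs :=
        (isOpen_lt ((continuous_id.sub continuous_const).norm.pow 2) continuous_const).mem_nhds
          hxs_lt
      filter_upwards [hU] with x hx
      exact hXmax (hKmem htsI hx.le)
    have hDW : fderiv ℝ W xs = 0 := IsLocalMax.fderiv_eq_zero hWmax
    have hΔW : (Δ W) xs ≤ 0 := IsLocalMax.laplacian_nonpos hW2 hWmax
    -- consequences: `Dv = Dg` and `Δv − Δg ≤ 0` at `(ts, xs)`
    have hvd : DifferentiableAt ℝ (v ts) xs := (hv2 ts).differentiable two_ne_zero xs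
    have hgd : DifferentiableAt ℝ (g ts) xs := (hg2 ts htsIoc).differentiable two_ne_zero xs
    have hDeq : fderiv ℝ (v ts) xs = fderiv ℝ (g ts) xs := by
      have h1 : fderiv ℝ W xs = fderiv ℝ (v ts) xs - fderiv ℝ (g ts) xs := by
        rw [hW, fderiv_sub_const, fderiv_fun_sub hvd hgd]
      rw [h1] at hDW
      exact sub_eq_zero.1 hDW
    have hΔeq : (Δ W) xs = (Δ (v ts)) xs - (Δ (g ts)) xs := by
      have h1 : W = (v ts - g ts) - fun _ => θ * (ts - t_b) := by funext x; simp [hW]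
      have hc1 : ContDiffAt ℝ 2 (v ts - g ts) xs := ((hv2 ts).sub (hg2 ts htsIoc)).contDiffAt
      rw [h1, hc1.laplacian_sub contDiffAt_const,
        (hv2 ts).contDiffAt.laplacian_sub (hg2 ts htsIoc).contDiffAt, laplacian_const]
      simp
    -- the continuous majorant `J` of the integrand, negative near `ts`
    set J : ℝ → ℝ := fun τ => (Δ (v τ)) xs - A * ‖fderiv ℝ (v τ) xs‖ - (Δ (g τ)) xs +
      A * ‖fderiv ℝ (g τ) xs‖ - θ with hJ
    have hJc : ContinuousOn J (Ioc t_b t_T) := by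
      refine (((((hvΔ_c xs).mono Ioc_subset_Icc_self).sub
        (continuousOn_const.mul ((hvD_c xs).mono Ioc_subset_Icc_self).norm)).sub
        (hgΔ_c xs)).add (continuousOn_const.mul (hgD_c xs).norm)).sub continuousOn_const
    have hJts : J ts ≤ -θ := by
      simp only [hJ, hDeq]
      linarith [hΔW, hΔeq]
    -- (a) `J < -θ/2` near `ts` within `(t_b, t_T]`
    obtain ⟨δ₁, hδ₁, hJneg⟩ : ∃ δ₁ > 0, ∀ τ ∈ Ioc t_b t_T, dist τ ts < δ₁ → J τ < -θ / 2 := by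
      have hev : ∀ᶠ τ in 𝓝[Ioc t_b t_T] ts, J τ < -θ / 2 :=
        (hJc ts htsIoc).eventually (gt_mem_nhds (by linarith))
      rw [eventually_nhdsWithin_iff, Metric.eventually_nhds_iff] at hev
      obtain ⟨δ₁, hδ₁, h⟩ := hev
      exact ⟨δ₁, hδ₁, fun τ hτ hd => h hd hτ⟩
    -- (b) `xs` stays inside the paraboloid for nearby times
    obtain ⟨δ₂, hδ₂, hins⟩ : ∃ δ₂ > 0, ∀ τ, dist τ ts < δ₂ → ‖xs - y‖ ^ 2 < P τ := by
      have hev : ∀ᶠ τ in 𝓝 ts, ‖xs - y‖ ^ 2 < P τ :=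
        hPc.continuousAt.eventually (lt_mem_nhds hxs_lt)
      rw [Metric.eventually_nhds_iff] at hev
      exact hev
    -- the earlier time `t₁`
    set δ : ℝ := min (min δ₁ δ₂) (ts - t_b) / 2 with hδ
    have hδpos : 0 < δ := by
      have : 0 < min (min δ₁ δ₂) (ts - t_b) := lt_min (lt_min hδ₁ hδ₂) (by linarith)
      rw [hδ]; linarith
    have hδ1 : δ < δ₁ := by
      have : min (min δ₁ δ₂) (ts - t_b) ≤ δ₁ := (min_le_left _ _).trans (min_le_left _ _)
      rw [hδ]; linarith
    have hδ2 : δ < δ₂ := by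
      have : min (min δ₁ δ₂) (ts - t_b) ≤ δ₂ := (min_le_left _ _).trans (min_le_right _ _)
      rw [hδ]; linarith
    have hδ3 : δ < ts - t_b := by
      have : min (min δ₁ δ₂) (ts - t_b) ≤ ts - t_b := min_le_right _ _
      rw [hδ]; linarith
    set t₁ : ℝ := ts - δ with ht₁
    have ht₁_gt : t_b < t₁ := by rw [ht₁]; linarith
    have ht₁_lt : t₁ < ts := by rw [ht₁]; linarith
    have hnear : ∀ τ ∈ Icc t₁ ts, dist τ ts < δ₁ ∧ dist τ ts < δ₂ ∧ τ ∈ Ioc t_b t_T := by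
      intro τ hτ
      have hd : dist τ ts ≤ δ := by
        rw [Real.dist_eq, abs_sub_comm, abs_of_nonneg (by linarith [hτ.2])]
        linarith [hτ.1]
      exact ⟨hd.trans_lt hδ1, hd.trans_lt hδ2, ⟨by linarith [hτ.1], hτ.2.trans htsI.2⟩⟩
    -- `(t₁, xs) ∈ K`, so `w (t₁, xs) ≤ w (ts, xs)`
    have ht₁K : (t₁, xs) ∈ K := by
      refine hKmem ⟨ht₁_gt.le, ht₁_lt.le.trans htsI.2⟩ ?_
      exact (hins t₁ (hnear t₁ ⟨le_rfl, ht₁_lt.le⟩).2.1).le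
    have hwle : w (t₁, xs) ≤ w (ts, xs) := hXmax ht₁K
    -- the integral identity for `w (ts, xs) - w (t₁, xs)`
    set I : ℝ → ℝ := fun τ => vt τ xs - ((Δ (g τ)) xs - fderiv ℝ (g τ) xs (a τ xs)) - θ with hI
    have hsubI : uIcc t₁ ts ⊆ Icc t_b t_T := by
      rw [uIcc_of_le ht₁_lt.le]; exact Icc_subset_Icc ht₁_gt.le htsI.2
    have hi1 : IntervalIntegrable (fun τ => vt τ xs) volume t₁ ts :=
      ((hvt_c xs).mono hsubI).intervalIntegrable
    have hvFTC : v ts xs - v t₁ xs = ∫ τ in t₁..ts, vt τ xs :=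
      (intervalIntegral.integral_eq_sub_of_hasDerivAt (fun τ hτ => hvt xs τ (hsubI hτ)) hi1).symm
    have hgFTC := hg_eq xs t₁ ts ht₁_gt ht₁_lt.le htsI.2
    have hi2 : IntervalIntegrable (fun τ => (Δ (g τ)) xs - fderiv ℝ (g τ) xs (a τ xs))
        volume t₁ ts := hint xs t₁ ts ht₁_gt ht₁_lt.le htsI.2
    have hi3 : IntervalIntegrable (fun _ : ℝ => θ) volume t₁ ts := intervalIntegrable_const
    have hdiff : w (ts, xs) - w (t₁, xs) = ∫ τ in t₁..ts, I τ := by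
      have h1 : ∫ τ in t₁..ts, I τ =
          (∫ τ in t₁..ts, vt τ xs) - (∫ τ in t₁..ts, ((Δ (g τ)) xs - fderiv ℝ (g τ) xs (a τ xs))) -
            ∫ τ in t₁..ts, θ := by
        rw [hI, intervalIntegral.integral_sub (hi1.sub hi2) hi3,
          intervalIntegral.integral_sub hi1 hi2]
      rw [h1, ← hvFTC, ← hgFTC, intervalIntegral.integral_const, smul_eq_mul]
      simp only [hw]
      ring
    -- pointwise: `I ≤ J < -θ/2` on `[t₁, ts]`
    have hIle : ∀ τ ∈ Icc t₁ ts, I τ ≤ -θ / 2 := by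
      intro τ hτ
      obtain ⟨hd1, hd2, hτI⟩ := hnear τ hτ
      have h1 : vt τ xs ≤ (Δ (v τ)) xs - A * ‖fderiv ℝ (v τ) xs‖ := hv_ineq τ hτI xs (hins τ hd2)
      have h2 : fderiv ℝ (g τ) xs (a τ xs) ≤ A * ‖fderiv ℝ (g τ) xs‖ := by
        calc fderiv ℝ (g τ) xs (a τ xs) ≤ ‖fderiv ℝ (g τ) xs (a τ xs)‖ := Real.le_norm_self _
          _ ≤ ‖fderiv ℝ (g τ) xs‖ * ‖a τ xs‖ := ContinuousLinearMap.le_opNorm _ _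
          _ ≤ ‖fderiv ℝ (g τ) xs‖ * A :=
              mul_le_mul_of_nonneg_left (ha τ hτI xs) (norm_nonneg _)
          _ = A * ‖fderiv ℝ (g τ) xs‖ := mul_comm _ _
      have h3 : I τ ≤ J τ := by
        simp only [hI, hJ]
        linarith
      exact h3.trans (hJneg τ hτI hd1).le
    have hIint : IntervalIntegrable I volume t₁ ts := (hi1.sub hi2).sub hi3
    have hint_le : ∫ τ in t₁..ts, I τ ≤ ∫ _ in t₁..ts, (-θ / 2 : ℝ) :=
      intervalIntegral.integral_mono_on ht₁_lt.le hIint intervalIntegrable_const hIle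
    have hneg : ∫ τ in t₁..ts, I τ < 0 := by
      refine hint_le.trans_lt ?_
      rw [intervalIntegral.integral_const, smul_eq_mul]
      nlinarith
    -- contradiction with maximality
    linarith [hdiff, hneg, hwle]
  -- `θ → 0`
  intro t ht x hx
  by_contra hcon
  push Not at hcon
  set d : ℝ := v t x - g t x with hd
  have hdpos : 0 < d := by rw [hd]; linarith
  have h := main (d / (2 * (t_T - t_b) + 2)) (by positivity) (t, x) (hKmem ht hx)
  simp only at h
  have h1 : d / (2 * (t_T - t_b) + 2) * (t - t_b) ≤ d / (2 * (t_T - t_b) + 2) * (t_T - t_b) :=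
    mul_le_mul_of_nonneg_left (by linarith [ht.2]) (by positivity)
  have h2 : d / (2 * (t_T - t_b) + 2) * (t_T - t_b) < d := by
    rw [div_mul_eq_mul_div, div_lt_iff₀ (by linarith)]
    nlinarith
  linarith

end Comparison

end Literature.Analysis.FluidPDE

end
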